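import Summits.QuantumFields.YangMills.Theorems.BalabanUVNodesN22W1RelCentredSliceInputsL2UOfBlocks
import Summits.QuantumFields.YangMills.Theorems.BalabanUVNodesN22W1RelCentredCovarianceNumerals

/-!
# BalabanUVNodes ∕ node N22 = NE9 — THE RELATIVE-DISC CENTRED ROAD OVER THE ADMISSIBLE CLASS, MODULE J26: THE LOCATED RECORD OF ONE SLICE AT NODE A's PACKAGE LETTERS — module J23's
# assembly `nonempty_of_blocks` with EVERY kernel letter of the record PINNED to NODE A's walk package (`K_G = K_Γ := K̄_Γ`, `K_Cs = K₀ := K̄_C`, `K_E := K̄_E`, the σ-difference sizes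
# `θ_• := 2K̄_•(e^{−εR_σ} + α∕R)`, the primed letters at the relative-disc radius `ρ_b`) and the three covariance letters at module J25's Schur constants (`c_E := K̄_C·m·(1+2∕κ_b)^ν`,
# `g := c_E·(K̄_Γ·m·(1+2∕κ_b)^ν)²`); eighteen of J23's hypotheses discharged BY NAME

Cell `pub-ymgap`, HUMAN RULING D-0062 (Track A), R134 ACCELERATION re-seat `pub-ymgap-dag-n22-c` (strategy s1), generation 11, file J26.  THEOREMS ONLY; imports J23
`…SliceInputsL2UOfBlocks` (`SliceInputsL2U.nonempty_of_blocks`, p588627) and J25 `…CovarianceNumerals` (`hCE_of_termWalkData ∕ eigenvalues_C_le_of_termWalkData ∕ hΓq_of_termWalkData`) BY NAME.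
`--supports` K3⁷ `SpineGivenEndpointR13SepCoPH` (stmt-QuantumFields-20544) as a helper.

WHY.  Module J23 keeps the record's kernel letters FREE, dominated by NODE A's package (`hKGw hKΓw hKCsw hK₀w hθΓw hθCw hθEw`), with the `C⁻¹` letter, the primed letters and the
covariance letters `c_E, g` as further hypotheses — the general consumer interface.  A producer holding NODE A's deliverable (ONE admissible package `w` with a walk record per term, cf.
`B13TermWalkDataOneTorus.ExistsWalkDataUniformSmall` ∕ `SmallTheta`, dag-n18-c's file 27 `…N18HLayerW1TermWalkRecordInputs226` for N18's record) wants the record AT THE PACKAGE: every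
kernel letter pinned to `w`, the covariance letters to module J25's Schur constants, so that what remains of the kernel side is exactly NODE A's NUMERICS — three dominations of the
perturbation size `θ` by explicit functions of `(K̄_Γ, K̄_E, K̄_C, e^{−εR_σ} + α∕R, ρ_b, m, ν, rates)` and the smallness `K̄_C·m(1+2∕κ_b)^ν·θ·m(1+2∕κ″)^ν < 1` — and the mixed
numerals read at explicit `O(1)` constants (print: [II] p. 16 «θ = O(1)e^{−⅓δ₀M} + O(α₀ + α₁)», «this yields a constant O(1)»).  THIS FILE is that edition: one application of J23 with
J25's three suppliers; no new estimate.

WHAT.  ★ `SliceInputsL2U.nonempty_of_blocks_atPackage` — J23's conclusion `Nonempty (SliceInputsL2U 𝔇 χu χcu (realSliceWilson Wc) (realSliceOlder Oc) c Sg Rz cs E₀ κ_E Z t W s₀ a a₅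
ρ_b Mv)` from J23's hypotheses with (K)'s seven relettering clauses, (O)'s `hKE ∕ hCE`, the five primed-letter clauses and (N)'s `hc0 ∕ hc ∕ hg ∕ hΓq` REMOVED (discharged by `le_rfl`,
`hw.hKbarE`, J25), and `hθEle ∕ hθΓle ∕ hθR1le ∕ hsmallKθ` and the sixteen remaining mixed numerals RESTATED at the pinned letters.

HONEST FRAMING — what this is NOT.  Count-neutral corollary of J23 + J25 BY NAME; NO estimate of Bałaban's is proved here; every hypothesis is a located input whose inhabitant at the
datum of record is another lane's (NODE A ∕ NODE O ∕ def-B13 ∕ N09 ∕ N10 ∕ def-W1; the window numerals are dag-n22-w1 ∕ w2's located points); no inhabitant of the record ∕ admissible tuple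
at the datum of record is claimed (K0 OPEN); N22 NOT discharged (typed 28∕28 · discharged 5∕27 UNCHANGED); NE9 NOT IN PRINT for d = 4; one finite four-torus programme at fixed ε — NOT
infinite volume, NOT OS on ℝ⁴, NOT a mass gap, NOT Clay.  0 `sorry`, 0 `def`, standard axioms.

References (TYPES only): [II] = [Balaban1988RG2Cluster] (1.5) p. 3, Lemma 1 (1.33)–(1.36) p. 9, (1.38)–(1.39) p. 10, Lemma 2 (1.41)–(1.43) p. 11, (2.2)–(2.3) p. 12, p. 13,
(2.14)–(2.26) pp. 15–17; [I] = [Balaban1987RG1] §1 p. 263, (2.6)–(2.13) pp. 266–268; [Balaban1985BackgroundPropagators] Thm 3.10 p. 416.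
-/

noncomputable section

namespace YMDAG.N22.W1

open Set Metric Matrix
open scoped BigOperators
open Literature.MathematicalPhysics.QuantumFieldTheory.Balaban1983to89
open Literature.MathematicalPhysics.QuantumFieldTheory.Balaban1983to89.TreeLengthTorus (TPt TDom tsys torusTreeLen torusTreeLen_nonneg)
open Literature.MathematicalPhysics.QuantumFieldTheory.Balaban1983to89.B13Bound143 (invTau)
open Literature.MathematicalPhysics.QuantumFieldTheory.Balaban1983to89.B9Thm37GlueTorus (tdist1)
open Literature.MathematicalPhysics.QuantumFieldTheory.Balaban1983to89.B5TorusCover (UT)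
open Literature.MathematicalPhysics.QuantumFieldTheory.Balaban1983to89.Step (SFConsts)
open Literature.MathematicalPhysics.QuantumFieldTheory.Balaban1983to89.Node00.Sect2 (domSys domCount CPair spaceI domSites Setting Residual)
open Literature.MathematicalPhysics.QuantumFieldTheory.Balaban1983to89.Node00.W1
open Literature.MathematicalPhysics.QuantumFieldTheory.Balaban1983to89.B13Term214 (term214 core214 F214)
open Literature.MathematicalPhysics.QuantumFieldTheory.Balaban1983to89.B12TreeDecay (kappa₀)
open Literature.MathematicalPhysics.QuantumFieldTheory.Balaban1983to89.B13ExpansionOrder (BeginsAt)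
open Literature.MathematicalPhysics.QuantumFieldTheory.Balaban1983to89.B13Lemma2LeadingParts (ofRealVec)
open Literature.MathematicalPhysics.QuantumFieldTheory.Balaban1983to89.B13TermWalkData (WalkConsts TermKernels TermWalkData)
open Summit.QuantumFields.YangMills.BalabanUVNodes

namespace SliceInputsL2U

variable {c : B13.Consts} {P : Params} {𝔸 : Type*} [NormedRing 𝔸] [NormedAlgebra ℂ 𝔸] [CompleteSpace 𝔸] {M k L : ℕ} [NeZero L] (𝔇 : TermDatum214 c P 𝔸 M k L)
  (χu χcu : (Z : (domSys P M (k + 1)).Dom) → (t : TermLabel P M k L) → ((𝔇.𝒦 Z t).Λ → ℝ) → ℝ)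
  {G : Type*} [GaugeGroup G] (Sg : Setting 𝔸 G) (Rz : Residual P 𝔸) (cs : SFConsts) (E₀ κE : ℝ)
  (Z : (domSys P M (k + 1)).Dom) (t : TermLabel P M k L) (W : Set (CPair P 𝔸)) (s₀ a a₅ ρb Mv : ℝ)

/-- **★ THE LOCATED RECORD OF ONE SLICE AT NODE A's PACKAGE LETTERS** — module J23's `nonempty_of_blocks` with the record's kernel letters PINNED to the walk package
(`KG = KΓ := w.KbarΓ`, `KCs = K₀ := w.KbarC`, `KE := w.KbarE`, `θΓ ∕ θE := 2K̄_•(e^{−εR_σ} + α∕R)`, `θC := K̄_C·θE·m(1+2∕(w.kap−κ_a))^ν·K̄_C·m(1+2∕(κ_a−κ_b))^ν`, primed letters at `ρ_b`) and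
the covariance letters at module J25's Schur constants (`cE := K̄_C·m·(1+2∕κ_b)^ν`, `g := cE·(K̄_Γ·m·(1+2∕κ_b)^ν)²`): the hypotheses are J23's with the seven relettering clauses, `hKE ∕ hCE`,
the five primed-letter clauses and `hc0 ∕ hc ∕ hg ∕ hΓq` REMOVED (`le_rfl`; `hw.hKbarE` and J25 `hCE_of_termWalkData`; `le_rfl`; J25 `eigenvalues_C_le_of_termWalkData ∕ hΓq_of_termWalkData`
at rate `κ_b ≤ w.kap`), and the three θ-dominations, the kernel smallness and the mixed numerals RESTATED at the pinned letters — what remains of the kernel side is NODE A's numerics.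
One application of J23; bookkeeping. [cite: Balaban1988RG2Cluster, (1.5) p.3, p.13, (2.14)-(2.16) pp.15-16, p.16 after (2.19), (2.17)-(2.26) pp.16-17; Balaban1987RG1, §1 p.263, (2.6)-(2.13) pp.266-268; Balaban1985BackgroundPropagators, Thm 3.10 p.416] -/
theorem nonempty_of_blocks_atPackage
    -- ═════════ THE THICKENING and the τ-letters of the constants (W1-8's elementary conditions on `c`; the datum's Cauchy radius against `κ₁`) ═════════
    (hW : IsOpen W) (hinv : ∀ d : ℝ, 0 ≤ d → 0 < invTau c d ∧ invTau c d ≤ 1 / 2) (hr : 0 < 𝔇.r) (hr' : 𝔇.r ≤ Real.exp c.κ₁ - 1)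
    -- the τ-radii bound the (2.19) regions `|τ| < τ(Y)⁻¹ + r + 2` on `𝐃` (the letter `R Y` of the profile and of the closures)
    (R : TDom P.d (L * domCount P M (k + 1)) → ℝ) (hRτ : ∀ Y ∈ t.1, (invTau c ((tsys P.d (L * domCount P M (k + 1))).dj Y))⁻¹ + 𝔇.r + 2 ≤ R Y)
    -- ═════════ THE KERNEL BLOCK — NODE A's WALK RECORD at the slice, re-keyed at `c⁺` (module J16's inputs VERBATIM), the reading map into the `α`-ball, symmetry ∕ `Re ≻ 0` of the precision ═════════
    {w : WalkConsts} {α Rσ₀ : ℝ} (hw : w.Admissible α Rσ₀) (hα : 0 < α)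
    (h𝒦 : TermWalkData ({ (𝔇.𝒦 Z t) with } : TermKernels ({ c with κ₁ := c.κ₁ + 1 } : B13.Consts) P.d (domCount P M (k + 1)) 𝔇.ν 𝔇.Nf 𝔇.E₃) w)
    (huOf : DifferentiableOn ℂ (𝔇.uOf Z t) W) (humaps : MapsTo (𝔇.uOf Z t) W (ball (0 : 𝔇.E₃) α))
    (hAsym : ∀ ξ ∈ W, ∀ σ : TPt P.d (domCount P M (k + 1)) → ℂ, (∀ j, ‖σ j‖ ≤ Real.exp (c.κ₁ + 1)) → (𝔇.A Z t ξ σ).IsSymm)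
    (hApos : ∀ ξ ∈ W, ∀ σ : TPt P.d (domCount P M (k + 1)) → ℂ, (∀ j, ‖σ j‖ ≤ Real.exp (c.κ₁ + 1)) → ((𝔇.A Z t ξ σ).map Complex.re).PosDef)
    -- the record's three rates: `kap := κb < κa < w.kap` (J16's drop), `kap'' < kap' < κb`
    {κa κb kap' kap'' : ℝ} (hκa : κa < w.kap) (hκb : κb < κa)
    (hkap'' : 0 < kap'')
    (hk1 : kap'' < kap')
    (hk2 : kap' < κb)
    -- the fibre count of the site locations, σ-HOLOMORPHY on the open `e^{κ₁+1}`-polydisc (NODE O); the perturbation size `θ` DOMINATING the package's primed letters (three clauses at NODE A's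
    -- `K̄_Γ, K̄_E, K̄_C`, the σ-difference sizes `θ_• = 2K̄_•(e^{−εR_σ} + α∕R)` and the relative-disc radius `ρ_b`); the kernel smallness at `K₀ := K̄_C`; `0 ≤ ρ_b < 1`
    {θ : ℝ}
    (hfibN : ∀ x : UT 𝔇.Nf, (Finset.univ.filter fun j => (𝔇.𝒦 Z t).locN j = x).card ≤ (𝔇.𝒦 Z t).m)
    (hAhol : ∀ ξ ∈ W, ∀ i j, DifferentiableOn ℂ (fun σ => 𝔇.A Z t ξ σ i j) {σ | ∀ j, σ j ∈ ball (0 : ℂ) (Real.exp (c.κ₁ + 1))})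
    (hGhol : ∀ ξ ∈ W, ∀ i j, DifferentiableOn ℂ (fun σ => (𝔇.𝒦 Z t).G2 σ (𝔇.uOf Z t ξ) i j) {σ | ∀ j, σ j ∈ ball (0 : ℂ) (Real.exp (c.κ₁ + 1))})
    (hθEle : ((2 * w.KbarE * Real.exp (-(w.ε * w.Rσ)) + 2 * w.KbarE * α / w.R) + ρb * (2 + ρb) * ((2 * w.KbarE * Real.exp (-(w.ε * w.Rσ)) + 2 * w.KbarE * α / w.R) + w.KbarE)) ≤ θ)
    (hθΓle : ((2 * w.KbarΓ * Real.exp (-(w.ε * w.Rσ)) + 2 * w.KbarΓ * α / w.R) + ρb * w.KbarΓ) ≤ θ)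
    (hθR1le : ((𝔇.𝒦 Z t).m * (1 + 2 / (κb - kap')) ^ 𝔇.ν) * ((𝔇.𝒦 Z t).m * (1 + 2 / (kap' - kap'')) ^ 𝔇.ν) * (((2 * w.KbarΓ * Real.exp (-(w.ε * w.Rσ)) + 2 * w.KbarΓ * α / w.R) + ρb * w.KbarΓ) * (((1 - ρb) ^ 2)⁻¹ * w.KbarC) * ((1 + ρb) * w.KbarΓ) + w.KbarΓ * ((w.KbarC * (2 * w.KbarE * Real.exp (-(w.ε * w.Rσ)) + 2 * w.KbarE * α / w.R) * ((𝔇.𝒦 Z t).m * (1 + 2 / (w.kap - κa)) ^ 𝔇.ν) * w.KbarC * ((𝔇.𝒦 Z t).m * (1 + 2 / (κa - κb)) ^ 𝔇.ν)) + ρb * (2 + ρb) * ((1 - ρb) ^ 2)⁻¹ * w.KbarC) * ((1 + ρb) * w.KbarΓ) + w.KbarΓ * w.KbarC * ((2 * w.KbarΓ * Real.exp (-(w.ε * w.Rσ)) + 2 * w.KbarΓ * α / w.R) + ρb * w.KbarΓ)) ≤ θ)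
    (hsmallKθ : w.KbarC * ((𝔇.𝒦 Z t).m * (1 + 2 / κb) ^ 𝔇.ν) * (θ * ((𝔇.𝒦 Z t).m * (1 + 2 / kap'') ^ 𝔇.ν)) < 1)
    (hρb0 : 0 ≤ ρb) (hρb1 : ρb < 1)
    -- ═════════ THE BOX BLOCK — PRINT'S BOXES on the term's row bonds (dag-n22-w1's at-datum inputs VERBATIM: the `Y₀`-bonds `Y0l`, the `P`-bonds `Pl` with node00-def-B13's count pin, threshold `ε₁`), base point `s₀ > 0`;
    -- the (2.22) letter `γ₂`, the tail letters `T, TP`, the box-tail rate `κ` and the large-field radius `r₁` against the knit's `a, Mv` at `rP = Rb = ε₁∕s₀` (the window numerals of dag-n22-w1 ∕ w2, displayed) ═════════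
    (Y0l Pl : (Z : (domSys P M (k + 1)).Dom) → (t : TermLabel P M k L) → Finset (𝔇.𝒦 Z t).Λ) {ε₁ : ℝ} (hε₁ : 0 < ε₁) (hs₀ : 0 < s₀)
    (hχu : ∀ Z t A, χu Z t A = ∏ b ∈ Y0l Z t, (if |A b| < ε₁ then (1 : ℝ) else 0))
    (hχcu : ∀ Z t A, χcu Z t A = ∏ b ∈ Pl Z t, (if ε₁ ≤ |A b| then (1 : ℝ) else 0)) (hPcard : (Pl Z t).card = t.2.card)
    {γ₂ T TP κ r₁ : ℝ}
    (hγ₂ : 0 ≤ γ₂)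
    (hκ : 0 ≤ κ)
    (hPa : a ≤ γ₂ * (ε₁ / s₀) ^ 2)
    (hr₁ : t.2 ≠ ∅ → r₁ ^ 2 ≤ (ε₁ / s₀) ^ 2)
    (hPa1 : t.2 ≠ ∅ → a ≤ γ₂ * r₁ ^ 2)
    (hRb : t.2 = ∅ → Real.exp (-(κ / 2 * (ε₁ / s₀) ^ 2)) ≤ T * s₀ ^ 2)
    (hTP : t.2 ≠ ∅ → Real.exp (-(γ₂ / 2 * ((ε₁ / s₀) ^ 2 - r₁ ^ 2))) ≤ TP * s₀ ^ 2)
    (hMvT : t.2 = ∅ → 1 + T ≤ Mv)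
    (hMvP : t.2 ≠ ∅ → TP ≤ Mv)
    -- ═════════ THE MIXED NUMERALS at NODE A's Schur constants `cE := K̄_C·m·(1+2∕κ_b)^ν`, `g := cE·(K̄_Γ·m·(1+2∕κ_b)^ν)²` (module J25) and `K₀ := K̄_C` (the (2.22) and quadratic rates, the volume bounds at rate `a₅`) ═════════
    {a' w' ac wc a₀ w₀ α₀ : ℝ}
    (hαc : (2 * (θ * ((𝔇.𝒦 Z t).m * (1 + 2 / kap'') ^ 𝔇.ν)) + (γ₂ + a')) * (w.KbarC * ((𝔇.𝒦 Z t).m * (1 + 2 / κb) ^ 𝔇.ν)) ≤ 1 / 2)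
    (hsmall : (2 * (θ * ((𝔇.𝒦 Z t).m * (1 + 2 / kap'') ^ 𝔇.ν)) + (γ₂ + a')) * (1 + 2 * (w.KbarC * ((𝔇.𝒦 Z t).m * (1 + 2 / κb) ^ 𝔇.ν)) * ((w.KbarC * ((𝔇.𝒦 Z t).m * (1 + 2 / κb) ^ 𝔇.ν)) * (w.KbarΓ * ((𝔇.𝒦 Z t).m * (1 + 2 / κb) ^ 𝔇.ν)) ^ 2)) ≤ 1 / 2)
    (hvol : 2 * (w.KbarC * ((𝔇.𝒦 Z t).m * (1 + 2 / κb) ^ 𝔇.ν) * (θ * ((𝔇.𝒦 Z t).m * (1 + 2 / kap'') ^ 𝔇.ν)) * (1 + (1 - w.KbarC * ((𝔇.𝒦 Z t).m * (1 + 2 / κb) ^ 𝔇.ν) * (θ * ((𝔇.𝒦 Z t).m * (1 + 2 / kap'') ^ 𝔇.ν)))⁻¹) / 2) * (Fintype.card (𝔇.𝒦 Z t).Λ : ℝ) + w' + (2 * (θ * ((𝔇.𝒦 Z t).m * (1 + 2 / kap'') ^ 𝔇.ν)) + (γ₂ + a')) * (w.KbarC * ((𝔇.𝒦 Z t).m *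 (1 + 2 / κb) ^ 𝔇.ν)) * (Fintype.card (𝔇.𝒦 Z t).Λ : ℝ) + (2 * (θ * ((𝔇.𝒦 Z t).m * (1 + 2 / kap'') ^ 𝔇.ν)) + (γ₂ + a')) * (1 + 2 * (w.KbarC * ((𝔇.𝒦 Z t).m * (1 + 2 / κb) ^ 𝔇.ν)) * ((w.KbarC * ((𝔇.𝒦 Z t).m * (1 + 2 / κb) ^ 𝔇.ν)) * (w.KbarΓ * ((𝔇.𝒦 Z t).m * (1 + 2 / κb) ^ 𝔇.ν)) ^ 2)) * (Fintype.card ((𝔇.𝒦 Z t).Λ ⊕ (𝔇.𝒦 Z t).C₀) : ℝ) ≤ a₅ * ((Z.1).card : ℝ))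
    (hαc_c : (2 * (θ * ((𝔇.𝒦 Z t).m * (1 + 2 / kap'') ^ 𝔇.ν)) + (γ₂ + ac)) * (w.KbarC * ((𝔇.𝒦 Z t).m * (1 + 2 / κb) ^ 𝔇.ν)) ≤ 1 / 2)
    (hsmall_c : (2 * (θ * ((𝔇.𝒦 Z t).m * (1 + 2 / kap'') ^ 𝔇.ν)) + (γ₂ + ac)) * (1 + 2 * (w.KbarC * ((𝔇.𝒦 Z t).m * (1 + 2 / κb) ^ 𝔇.ν)) * ((w.KbarC * ((𝔇.𝒦 Z t).m * (1 + 2 / κb) ^ 𝔇.ν)) * (w.KbarΓ * ((𝔇.𝒦 Z t).m * (1 + 2 / κb) ^ 𝔇.ν)) ^ 2)) ≤ 1 / 2)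
    (hvol_c : 2 * (w.KbarC * ((𝔇.𝒦 Z t).m * (1 + 2 / κb) ^ 𝔇.ν) * (θ * ((𝔇.𝒦 Z t).m * (1 + 2 / kap'') ^ 𝔇.ν)) * (1 + (1 - w.KbarC * ((𝔇.𝒦 Z t).m * (1 + 2 / κb) ^ 𝔇.ν) * (θ * ((𝔇.𝒦 Z t).m * (1 + 2 / kap'') ^ 𝔇.ν)))⁻¹) / 2) * (Fintype.card (𝔇.𝒦 Z t).Λ : ℝ) + wc + (2 * (θ * ((𝔇.𝒦 Z t).m * (1 + 2 / kap'') ^ 𝔇.ν)) + (γ₂ + ac)) * (w.KbarC * ((𝔇.𝒦 Z t).m * (1 + 2 / κb) ^ 𝔇.ν)) * (Fintype.card (𝔇.𝒦 Z t).Λ : ℝ) + (2 * (θ * ((𝔇.𝒦 Z t).m * (1 + 2 / kap'') ^ 𝔇.ν)) + (γ₂ + ac)) * (1 + 2 * (w.KbarC * ((𝔇.𝒦 Z t).m * (1 + 2 / κb) ^ 𝔇.ν)) * ((w.KbarC * ((𝔇.𝒦 Z t).m * (1 + 2 / κb) ^ 𝔇.ν)) * (w.KbarΓ * ((𝔇.𝒦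 Z t).m * (1 + 2 / κb) ^ 𝔇.ν)) ^ 2)) * (Fintype.card ((𝔇.𝒦 Z t).Λ ⊕ (𝔇.𝒦 Z t).C₀) : ℝ) ≤ a₅ * ((Z.1).card : ℝ))
    (ha₀ : 0 ≤ a₀)
    (hαc_b : (2 * (θ * ((𝔇.𝒦 Z t).m * (1 + 2 / kap'') ^ 𝔇.ν)) + (κ + a₀)) * (w.KbarC * ((𝔇.𝒦 Z t).m * (1 + 2 / κb) ^ 𝔇.ν)) ≤ 1 / 2)
    (hsmall_b : (2 * (θ * ((𝔇.𝒦 Z t).m * (1 + 2 / kap'') ^ 𝔇.ν)) + (κ + a₀)) * (1 + 2 * (w.KbarC * ((𝔇.𝒦 Z t).m * (1 + 2 / κb) ^ 𝔇.ν)) * ((w.KbarC * ((𝔇.𝒦 Z t).m * (1 + 2 / κb) ^ 𝔇.ν)) * (w.KbarΓ * ((𝔇.𝒦 Z t).m * (1 + 2 / κb) ^ 𝔇.ν)) ^ 2)) ≤ 1 / 2)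
    (hvol_b : 2 * (w.KbarC * ((𝔇.𝒦 Z t).m * (1 + 2 / κb) ^ 𝔇.ν) * (θ * ((𝔇.𝒦 Z t).m * (1 + 2 / kap'') ^ 𝔇.ν)) * (1 + (1 - w.KbarC * ((𝔇.𝒦 Z t).m * (1 + 2 / κb) ^ 𝔇.ν) * (θ * ((𝔇.𝒦 Z t).m * (1 + 2 / kap'') ^ 𝔇.ν)))⁻¹) / 2) * (Fintype.card (𝔇.𝒦 Z t).Λ : ℝ) + w₀ + (2 * (θ * ((𝔇.𝒦 Z t).m * (1 + 2 / kap'') ^ 𝔇.ν)) + (κ + a₀)) * (w.KbarC * ((𝔇.𝒦 Z t).m * (1 + 2 / κb) ^ 𝔇.ν)) * (Fintype.card (𝔇.𝒦 Z t).Λ : ℝ) + (2 * (θ * ((𝔇.𝒦 Z t).m * (1 + 2 / kap'') ^ 𝔇.ν)) + (κ + a₀)) * (1 + 2 * (w.KbarC * ((𝔇.𝒦 Z t).m * (1 + 2 / κb) ^ 𝔇.ν)) * ((w.KbarC * ((𝔇.𝒦 Z t).m * (1 + 2 / κb) ^ 𝔇.ν)) * (w.KbarΓ * ((𝔇.𝒦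 Z t).m * (1 + 2 / κb) ^ 𝔇.ν)) ^ 2)) * (Fintype.card ((𝔇.𝒦 Z t).Λ ⊕ (𝔇.𝒦 Z t).C₀) : ℝ) ≤ a₅ * ((Z.1).card : ℝ))
    (hα₀ : 0 ≤ α₀)
    (hαc_f : (2 * (θ * ((𝔇.𝒦 Z t).m * (1 + 2 / kap'') ^ 𝔇.ν)) + α₀) * (w.KbarC * ((𝔇.𝒦 Z t).m * (1 + 2 / κb) ^ 𝔇.ν)) ≤ 1 / 2)
    (hsmall_f : (2 * (θ * ((𝔇.𝒦 Z t).m * (1 + 2 / kap'') ^ 𝔇.ν)) + α₀) * (1 + 2 * (w.KbarC * ((𝔇.𝒦 Z t).m * (1 + 2 / κb) ^ 𝔇.ν)) * ((w.KbarC * ((𝔇.𝒦 Z t).m * (1 + 2 / κb) ^ 𝔇.ν)) * (w.KbarΓ * ((𝔇.𝒦 Z t).m * (1 + 2 / κb) ^ 𝔇.ν)) ^ 2)) ≤ 1 / 2)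
    (hαc_0 : (2 * (θ * ((𝔇.𝒦 Z t).m * (1 + 2 / kap'') ^ 𝔇.ν)) + (γ₂ + a₀)) * (w.KbarC * ((𝔇.𝒦 Z t).m * (1 + 2 / κb) ^ 𝔇.ν)) ≤ 1 / 2)
    (hsmall_0 : (2 * (θ * ((𝔇.𝒦 Z t).m * (1 + 2 / kap'') ^ 𝔇.ν)) + (γ₂ + a₀)) * (1 + 2 * (w.KbarC * ((𝔇.𝒦 Z t).m * (1 + 2 / κb) ^ 𝔇.ν)) * ((w.KbarC * ((𝔇.𝒦 Z t).m * (1 + 2 / κb) ^ 𝔇.ν)) * (w.KbarΓ * ((𝔇.𝒦 Z t).m * (1 + 2 / κb) ^ 𝔇.ν)) ^ 2)) ≤ 1 / 2)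
    (hvol_0 : 2 * (w.KbarC * ((𝔇.𝒦 Z t).m * (1 + 2 / κb) ^ 𝔇.ν) * (θ * ((𝔇.𝒦 Z t).m * (1 + 2 / kap'') ^ 𝔇.ν)) * (1 + (1 - w.KbarC * ((𝔇.𝒦 Z t).m * (1 + 2 / κb) ^ 𝔇.ν) * (θ * ((𝔇.𝒦 Z t).m * (1 + 2 / kap'') ^ 𝔇.ν)))⁻¹) / 2) * (Fintype.card (𝔇.𝒦 Z t).Λ : ℝ) + w₀ + (2 * (θ * ((𝔇.𝒦 Z t).m * (1 + 2 / kap'') ^ 𝔇.ν)) + (γ₂ + a₀)) * (w.KbarC * ((𝔇.𝒦 Z t).m * (1 + 2 / κb) ^ 𝔇.ν)) * (Fintype.card (𝔇.𝒦 Z t).Λ : ℝ) + (2 * (θ * ((𝔇.𝒦 Z t).m * (1 + 2 / kap'') ^ 𝔇.ν)) + (γ₂ + a₀)) * (1 + 2 * (w.KbarC * ((𝔇.𝒦 Z t).m * (1 + 2 / κb) ^ 𝔇.ν)) * ((w.KbarC * ((𝔇.𝒦 Z t).m * (1 + 2 / κb) ^ 𝔇.ν)) * (w.KbarΓ * ((𝔇.𝒦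 Z t).m * (1 + 2 / κb) ^ 𝔇.ν)) ^ 2)) * (Fintype.card ((𝔇.𝒦 Z t).Λ ⊕ (𝔇.𝒦 Z t).C₀) : ℝ) ≤ a₅ * ((Z.1).card : ℝ))
    -- ═════════ THE WILSON BLOCK — ONE ANALYTIC LOCALIZED ACTION READING (dag-n22-w3's J22 `wilsonBlock_of_wilsonOfActionOn` inputs VERBATIM, on node00-def-W1's W1-17d `LocActionC ∕ WilsonOfActionOn`):
    -- the complex Wilson remainder `Wc` IS the third-order remainder of `𝒜` on `W × 𝔅c` (`𝔅c` open, `⊇ ball 0 RA ∋` the box: `ε₁ < RA`, containing every real field), `𝒜` jointly analytic, sup letter `M𝒜`,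
    -- real-slice measurable, local through the supports `S Y ⊆ Y0l` located in `Y`; letter `M𝒲 ≥ wilsonSupBound M𝒜 = 8·M𝒜`; profile letters `Cp κp` and the (2.19) profile at the τ-radii; box radius `ρ := ε₁`, `S₀ := Y0l Z t` ═════════
    (Wc : 𝔇.ComplexWilson) (𝒜 : 𝔇.LocActionC Z t) {𝔅c : Set ((𝔇.𝒦 Z t).Λ → ℂ)} {RA : ℝ} (hε₁RA : ε₁ < RA)
    (hWA : 𝔇.WilsonOfActionOn Wc Z t 𝒜 W 𝔅c) (h𝔅o : IsOpen 𝔅c) (h𝔅 : ball 0 RA ⊆ 𝔅c) (h𝔅r : ∀ A : (𝔇.𝒦 Z t).Λ → ℝ, ofRealVec A ∈ 𝔅c) (hAj : 𝒜.JointHoloOn W 𝔅c)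
    {M𝒜 : TDom P.d (L * domCount P M (k + 1)) → ℝ} (hAM : 𝒜.SupBoundOn W RA M𝒜) (hM𝒜 : ∀ Y ∈ t.1, 0 ≤ M𝒜 Y) (hAm : 𝒜.RealSliceMeasurable W)
    (S : TDom P.d (L * domCount P M (k + 1)) → Finset (𝔇.𝒦 Z t).Λ) (hAloc : 𝒜.LocalInC W S) (cubeOf : (𝔇.𝒦 Z t).Λ → TPt P.d (L * domCount P M (k + 1)))
    (M𝒲 : TDom P.d (L * domCount P M (k + 1)) → ℝ) (hM𝒲c : ∀ Y, TermDatum214.wilsonSupBound M𝒜 Y ≤ M𝒲 Y) {Cp κp : ℝ}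
    (hS : ∀ Y ∈ t.1, ∀ b ∈ S Y, cubeOf b ∈ Y.1)
    (hCp : 0 ≤ Cp)
    (hκp : kappa₀ (4 * 2 ^ P.d) (2 * P.d) ≤ κp)
    (hSS₀ : ∀ Y ∈ t.1, ∀ b ∈ S Y, b ∈ Y0l Z t)
    (hdecay : ∀ Y ∈ t.1, R Y * (M𝒲 Y / RA ^ 3) ≤ Cp * Real.exp (-κp * (tsys P.d (L * domCount P M (k + 1))).dj Y))
    -- ═════════ THE OLDER-TERMS BLOCK — ONE COMPLEX READING on the admissible class, the thickening and every complex field (module J20 §2's inputs VERBATIM; letter `M𝒪 ≥ crudeBound`) ═════════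
    (Oc : 𝔇.ComplexOlder) {Sa : Type*} [MeasurableSpace Sa] [TopologicalSpace Sa] [OpensMeasurableSpace Sa] {Ra : 𝔇.ReadingAtomsC Z t Sa} {C mu : ℝ}
    {m : TDom P.d (L * domCount P M (k + 1)) → (j : Fin (k + 1)) → (domSys P M j).Dom → ℝ}
    (hread : 𝔇.ReadsOnByC Oc Z t Ra (AdmHist (spaceOfRecord (M := M) Sg Rz (fun _ => cs.α₀) (fun _ => cs.α₁)) E₀ κE k) W univ)
    (hRmaps : Ra.MapsToTablesC (fun j X => spaceI Sg Rz M j (domSites P M j X) cs.α₀ cs.α₁) W univ) (hRholξ : Ra.CfgCHoloOn W univ) (hRhol : Ra.CfgFieldHoloOn W univ)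
    (hRjc : Ra.CfgCJointContinuous) (hC : 0 ≤ C) (hE₀ : 0 ≤ E₀) (hRK : Ra.KernelBounded C) (hRμ : Ra.FiniteMass mu) (hm : ∀ Y j X, 0 ≤ m Y j X) (hRμm : Ra.FiniteMassAt m)
    (hRloc : Ra.LocalInC ((Y0l Z t : Finset (𝔇.𝒦 Z t).Λ) : Set (𝔇.𝒦 Z t).Λ))
    (M𝒪 : TDom P.d (L * domCount P M (k + 1)) → ℝ) (hM𝒪c : ∀ Y, TermDatum214.crudeBound C E₀ κE m Y ≤ M𝒪 Y)
    -- ═════════ THE CLOSURES (slice letters `a′ w′ a_c w_c w₀`, centred split `δ`; VERBATIM at `ρ := ε₁`) ═════════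
    {δ : ℝ}
    (hδ : 0 < δ)
    (ha' : (1 + ρb) ^ 2 * (2 * ε₁ * (Cp * B12TreeDecay.K₀ (4 * 2 ^ P.d) (2 * P.d))) ≤ a')
    (hw' : (1 + ρb) ^ 2 * (∑ Y ∈ t.1, R Y * (M𝒪 Y + (2 * M𝒪 Y / RA) * ε₁)) ≤ w')
    (hac : 2 * δ + 8 * ε₁ * (Cp * B12TreeDecay.K₀ (4 * 2 ^ P.d) (2 * P.d)) ≤ ac)
    (hwc : Real.exp (∑ Y ∈ t.1, R Y * M𝒪 Y) * ((∑ Y ∈ t.1, R Y * ((4 * (2 * M𝒲 Y / RA ^ 4) + (4 * (M𝒲 Y / RA ^ 3) + 4 * (M𝒲 Y / RA ^ 3)) / ε₁) * (4 / (Real.exp 1 * δ)) ^ 4 + ((4 * M𝒪 Y / RA ^ 2) + ((2 * M𝒪 Y / RA) + (2 * M𝒪 Y / RA)) / ε₁) * (2 / (Real.exp 1 * δ)) ^ 2)) * Real.exp (δ / 2) + ((∑ Y ∈ t.1, R Y * (4 * (M𝒲 Y / RA ^ 3) * (3 / (Real.exp 1 * δ)) ^ 3 + (2 * M𝒪 Y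 / RA) * (1 / (Real.exp 1 * δ)))) * Real.exp (δ / 2)) ^ 2 * Real.exp ((∑ Y ∈ t.1, R Y * (M𝒪 Y + (2 * M𝒪 Y / RA) * ε₁)) + ∑ Y ∈ t.1, R Y * M𝒪 Y)) ≤ Real.exp wc)
    (hw₀ : ∑ Y ∈ t.1, R Y * M𝒪 Y ≤ w₀)
    : Nonempty (SliceInputsL2U 𝔇 χu χcu (𝔇.realSliceWilson Wc) (𝔇.realSliceOlder Oc) c Sg Rz cs E₀ κE Z t W s₀ a a₅ ρb Mv) := by
  have hκb0 : 0 < κb := hkap''.trans (hk1.trans hk2)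
  have hκbw : κb ≤ w.kap := (hκb.trans hκa).le
  have hKbC := hw.hKbarC
  have hKbΓ := hw.hKbarΓ
  exact nonempty_of_blocks 𝔇 χu χcu Sg Rz cs E₀ κE Z t W s₀ a a₅ ρb Mv hW hinv hr hr' R hRτ hw hα h𝒦 huOf humaps hAsym hApos hκa hκb hkap'' hk1 hk2
    (KG := w.KbarΓ) (KΓ := w.KbarΓ) (KCs := w.KbarC) (K₀ := w.KbarC) (KE := w.KbarE)
    (θΓ := 2 * w.KbarΓ * Real.exp (-(w.ε * w.Rσ)) + 2 * w.KbarΓ * α / w.R)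
    (θC := w.KbarC * (2 * w.KbarE * Real.exp (-(w.ε * w.Rσ)) + 2 * w.KbarE * α / w.R) * ((𝔇.𝒦 Z t).m * (1 + 2 / (w.kap - κa)) ^ 𝔇.ν) * w.KbarC *
      ((𝔇.𝒦 Z t).m * (1 + 2 / (κa - κb)) ^ 𝔇.ν))
    (θE := 2 * w.KbarE * Real.exp (-(w.ε * w.Rσ)) + 2 * w.KbarE * α / w.R) (θ := θ)
    le_rfl le_rfl le_rfl le_rfl le_rfl le_rfl le_rfl hw.hKbarE (hCE_of_termWalkData 𝔇 Z t hw hα h𝒦 hκbw) hfibN hAhol hGhol le_rfl le_rfl le_rfl le_rfl le_rfl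
    hθEle hθΓle hθR1le hsmallKθ hρb0 hρb1 Y0l Pl hε₁ hs₀ hχu hχcu hPcard hγ₂ hκ hPa hr₁ hPa1 hRb hTP hMvT hMvP
    (by positivity) (eigenvalues_C_le_of_termWalkData 𝔇 Z t hw hα h𝒦 hκb0 hκbw) hαc (by positivity) (hΓq_of_termWalkData 𝔇 Z t hw hα h𝒦 hκb0 hκbw hfibN)
    hsmall hvol hαc_c hsmall_c hvol_c ha₀ hαc_b hsmall_b hvol_b hα₀ hαc_f hsmall_f hαc_0 hsmall_0 hvol_0
    Wc 𝒜 hε₁RA hWA h𝔅o h𝔅 h𝔅r hAj hAM hM𝒜 hAm S hAloc cubeOf M𝒲 hM𝒲c hS hCp hκp hSS₀ hdecay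
    Oc hread hRmaps hRholξ hRhol hRjc hC hE₀ hRK hRμ hm hRμm hRloc M𝒪 hM𝒪c hδ ha' hw' hac hwc hw₀

end SliceInputsL2U

end YMDAG.N22.W1

end
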